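import Literature.AlgebraicGeometry.Frobenioids.NaiveFrobeniusFunctorLifts
import HarnessLib

/-!
# Frobenioids I, Prop. 1.10 (i) as the §2 lifting hypothesis `HasFrobeniusLifts`: its universal closure
# over ALL functors `C → F_Φ` is REFUTED (a four-object poset pre-Frobenioid) — PROOF-ONLY

Mochizuki, *The geometry of Frobenioids I: the general theory*, Kyushu J. Math. **62** (2008)
293–400, Prop. 1.10 (i) kurims p. 34 and Prop. 2.1 p. 44 [cite: MochizukiFrdI2008, Prop. 1.10(i) p.34].

abc-iut cell, FACT-LIST wave F (seat f-044, tranche 44), row **F-1159**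
`PreFrobenioid.HasFrobeniusLifts (F : C ⥤ ElemFrobenioid Φ) (d : ℕ+)` (`NaiveFrobeniusFunctor.lean`):
the conclusion of Prop. 1.10 (i) in degree `d` — unique lifting of `φ : A → B` along morphisms of
Frobenius type `α : A → A'`, `β : B → B'` of Frobenius degree `d` — typed as a named HYPOTHESIS of §2
over an ARBITRARY functor `F`.  Its instance form, for `F` a FROBENIOID, is the tree's theorem
`PreFrobenioid.hasFrobeniusLifts (hF : IsFrobenioid F) (d) : HasFrobeniusLifts F d`
(`NaiveFrobeniusFunctorLifts.lean`, from seat L1-t1's Prop. 1.10 (i)), which is what every consumer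
uses; the row stayed *conditional* only because the universal closure over all `F` has no witness.
This file records the kernel event classifying the row (R5): that universal closure is FALSE.

Countermodel (not in the paper; elementary): `D` = the one-morphism category, `Φ` = the trivial monoid
on it, `C` = the poset of subsets of `{0, 1}`, and `F : C → F_Φ` sending `X ⊆ Y` to the morphism
`(id, 0, 2^{|Y| - |X|})`.  Every arrow of `C` is then an isometric base-isomorphism, and it is linear
iff it is an identity, so every arrow is co-angular, i.e. of Frobenius type; `α : ∅ ⊆ {0}` and
`β : ∅ ⊆ {1}` have Frobenius degree `2`, but `φ = id_∅` admits NO lift `{0} → {1}`.  (This `F` is of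
course not a Frobenioid: e.g. `∅` has no endomorphism of Frobenius degree `2`.)  A refuted universal
closure says the row is a hypothesis on data, not that anything in print is false; no statement of the
paper is strengthened; nothing here takes a side on [IUTchIII] Cor. 3.12.
-/

namespace Literature.AlgebraicGeometry.Frobenioids

open CategoryTheory Opposite

namespace PreFrobenioid

/-- **F-1159: the universal closure of the §2 lifting hypothesis `HasFrobeniusLifts` (Prop. 1.10 (i) as
a schema over ALL functors `F : C → F_Φ`) is FALSE** — witness: the poset of subsets of `{0,1}` over
the one-morphism base with trivial divisor monoid and Frobenius degrees `2^{|Y|-|X|}`; there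
`∅ ⊆ {0}`, `∅ ⊆ {1}` are morphisms of Frobenius type of degree `2` along which `id_∅` has no lift.  The
instance form for Frobenioids is `PreFrobenioid.hasFrobeniusLifts`. [cite: MochizukiFrdI2008, Prop. 1.10(i) p.34] -/
theorem not_forall_hasFrobeniusLifts :
    ¬ ∀ (D : Type) [Category.{0} D] (Φ : Dᵒᵖ ⥤ CommMonCat.{0}) (C : Type) [Category.{0} C]
        (F : C ⥤ ElemFrobenioid Φ) (d : ℕ+),
        Literature.AlgebraicGeometry.Frobenioids.PreFrobenioid.HasFrobeniusLifts F d := by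
  intro h
  -- the base: one object, one morphism, trivial divisor monoid
  let Φ : (Discrete PUnit.{1})ᵒᵖ ⥤ CommMonCat.{0} := constMonoidOn PUnit.{1}
  let P : ElemFrobenioid Φ := ElemFrobenioid.of Φ (Discrete.mk PUnit.unit)
  -- the pre-Frobenioid: subsets of `{0,1}`, `X ⊆ Y ↦ (id, 0, 2^{|Y|-|X|})`
  let F : Finset (Fin 2) ⥤ ElemFrobenioid Φ :=
    { obj := fun _ => P
      map := fun {X Y} _ => ElemFrobenioid.homMk (𝟙 _) 1 ((2 : ℕ+) ^ (Y.card - X.card))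
      map_id := fun X => by
        refine ElemFrobenioid.Hom.ext (Subsingleton.elim _ _) rfl ?_
        change (2 : ℕ+) ^ (X.card - X.card) = 1
        rw [Nat.sub_self, pow_zero]
      map_comp := fun {X Y Z} f g => by
        have hXY : X.card ≤ Y.card := Finset.card_le_card f.le
        have hYZ : Y.card ≤ Z.card := Finset.card_le_card g.le
        refine ElemFrobenioid.Hom.ext (Subsingleton.elim _ _) ?_ ?_
        · change (1 : Φ.obj (op P.base)) =
            pull Φ (𝟙 P.base) 1 * 1 ^ (((2 : ℕ+) ^ (Z.card - Y.card) : ℕ+) : ℕ)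
          rw [map_one, one_pow, mul_one]
        · change (2 : ℕ+) ^ (Z.card - X.card) =
            (2 : ℕ+) ^ (Y.card - X.card) * (2 : ℕ+) ^ (Z.card - Y.card)
          rw [← pow_add]
          congr 1
          omega }
  -- in `C`, a linear arrow (degree `2^{|Y|-|X|} = 1`) is an identity, hence an isomorphism
  have lin_iso : ∀ {X Y : Finset (Fin 2)} (b : X ⟶ Y), degFr F b = 1 → IsIso b := by
    intro X Y b hb
    have hXY : X ⊆ Y := b.le
    have hdeg : (2 : ℕ+) ^ (Y.card - X.card) = 1 := hb
    have h2 : (2 : ℕ) ^ (Y.card - X.card) = 1 := by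
      have := congrArg PNat.val hdeg
      simpa using this
    have hc : Y.card ≤ X.card := by
      rcases Nat.pow_eq_one.mp h2 with h | h
      · exact absurd h (by norm_num)
      · omega
    obtain rfl : X = Y := Finset.eq_of_subset_of_card_le hXY hc
    exact ⟨⟨𝟙 X, Subsingleton.elim _ _, Subsingleton.elim _ _⟩⟩
  -- hence EVERY arrow of `C` is of Frobenius type
  have frob : ∀ {X Y : Finset (Fin 2)} (f : X ⟶ Y), IsFrobeniusType F f := by
    intro X Y f
    refine ⟨⟨?_, rfl⟩, ?_⟩
    · intro X' Y' γ b a _ _ _ hb _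
      exact lin_iso b hb.1
    · change IsIso (𝟙 P.base)
      infer_instance
  -- `α : ∅ ⊆ {0}`, `β : ∅ ⊆ {1}` have Frobenius degree 2; `id_∅` has no lift `{0} → {1}`
  let A : Finset (Fin 2) := ∅
  let A' : Finset (Fin 2) := {0}
  let B' : Finset (Fin 2) := {1}
  let α : A ⟶ A' := homOfLE (Finset.empty_subset _)
  let β : A ⟶ B' := homOfLE (Finset.empty_subset _)
  have hα : degFr F α = 2 := by
    change (2 : ℕ+) ^ (A'.card - A.card) = 2
    simp [A, A']
  have hβ : degFr F β = 2 := by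
    change (2 : ℕ+) ^ (B'.card - A.card) = 2
    simp [A, B']
  obtain ⟨φ', -⟩ := (h (Discrete PUnit.{1}) Φ (Finset (Fin 2)) F 2 (𝟙 A) α β
    (frob α) hα (frob β) hβ).1.exists
  have hle : A' ⊆ B' := φ'.le
  exact absurd hle (by decide)

end PreFrobenioid

end Literature.AlgebraicGeometry.Frobenioids
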